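import Mathlib
import Summits.Ventures.PercRepro2.CoinForestHead
import Summits.Ventures.PercRepro2.CoinPreHead

/-!
# Row 2′DARC at the DIAMOND: a random pre-head arm into the head of a pendant forest (blind cell
PercRepro2, night-2 g6; proofs/NIGHT2-DARC.md §29)

`darc_of_preHead_forest`: the gate head `w` has exactly one coin, the arm `e = {w → v₀}` (any
probability), nothing enters `w`, and `v₀` is the head of a pendant forest in the sense of
`darc_of_forestHead_mixed` (arms `v₀ → v` of any probabilities into a subset `A` of the forest
`Vs`, forest coins `v → par v`, the arm and forest coins the only coins leaving `{v₀} ∪ Vs`, entries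
from the core into `v₀ ∪ Vs ∪ {t}` arbitrary).  Then row 2′DARC holds at the arc `u → w`.
Proof: `darc_of_preHead` (the functional is affine in the arm probability; pinned closed it is
directed BHK, pinned open the gate `u → w` is the gate `u → v₀`) and the forest theorem at `v₀`
in the system with the arm pinned open — whose reduced avoidance events have the same probabilities
as in the original system, because the arm is never seen from `s` (`prob_update_one_eq_of_unentered`).

`darc_of_diamond`: the instance `Vs = {v₁, v₂}`, `par ≡ t`, `A = {v₁, v₂}` — the head
`w → v₀ → {v₁, v₂} → t` with `v₀` an OR-vertex (out-degree 2, inner arcs of ANY probabilities),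
the first head outside the forest theorem (its trace law is not log-supermodular, §27.6) in the
kernel.  Its hypotheses are sharp for the method: §28 shows the argument cannot absorb entries
into `w`.
-/

namespace Summit.Ventures.PercRepro2.Coin

open Classical

section PreHeadForest

variable {V : Type*} {E : Type*} [Fintype V] [DecidableEq V] [Fintype E] [DecidableEq E]
  {R : Type*} [Field R] [LinearOrder R] [IsStrictOrderedRing R]

omit [Fintype V] [Fintype E] [DecidableEq E] [Field R] [LinearOrder R] [IsStrictOrderedRing R] in
/-- The reduced arc map of an unentered vertex `w` still has no arc into `w`. -/
lemma arcsOff_noIn {arcs : E → Finset (V × V)} {w : V} (hin : ∀ e, ∀ xy ∈ arcs e, xy.2 ≠ w)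
    (Z : Finset V) : ∀ e, ∀ xy ∈ arcsOff arcs Z e, xy.2 ≠ w := fun e xy hxy =>
  hin e xy (Finset.mem_filter.mp hxy).1

omit [Fintype V] [Fintype E] [DecidableEq E] [Field R] [LinearOrder R] [IsStrictOrderedRing R] in
/-- The reduced arcs of a coin leaving `w` still leave `w`. -/
lemma arcsOff_tail {arcs : E → Finset (V × V)} {w : V} {e : E} (he : ∀ xy ∈ arcs e, xy.1 = w)
    (Z : Finset V) : ∀ xy ∈ arcsOff arcs Z e, xy.1 = w := fun xy hxy =>
  he xy (Finset.mem_filter.mp hxy).1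

omit [Fintype V] [LinearOrder R] [IsStrictOrderedRing R] in
/-- Pinning an unentered coin open does not change the probability of a reduced avoidance event. -/
lemma prob_update_one_eq_of_unentered (p : E → R) {arcs : E → Finset (V × V)} {w : V}
    (hin : ∀ e, ∀ xy ∈ arcs e, xy.2 ≠ w) {e : E} (he : ∀ xy ∈ arcs e, xy.1 = w) {s : V}
    (hs : s ≠ w) (Z T : Finset V) :
    prob (Function.update p e 1) (avoidEvent (arcsOff arcs Z) s T) =
      prob p (avoidEvent (arcsOff arcs Z) s T) := by
  simp only [prob_eq_expect_indicator]
  exact expect_update_one_of_dependsOn p (dependsOn_indicator_mul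
    (dependsOn_avoidEvent_of_unentered (arcsOff_noIn hin Z) (arcsOff_tail he Z) hs T) dependsOn_one)

/-- **Row 2′DARC at a random pre-head arm into the head of a pendant forest.** -/
theorem darc_of_preHead_forest (p : E → R) (hp : IsProbVec p) {arcs : E → Finset (V × V)}
    (hS : SameEnds arcs) (s a b u w v₀ t : V) (e : E) (he : arcs e = {(w, v₀)})
    (hin : ∀ e', ∀ xy ∈ arcs e', xy.2 ≠ w) (hout : ∀ e', (∃ xy ∈ arcs e', xy.1 = w) → e' = e)
    (hs : s ≠ w) (hwt : w ≠ t) (Vs : Finset V) (hv₀V : v₀ ∉ Vs) (htV : t ∉ Vs) (hv₀t : v₀ ≠ t)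
    (A : Finset V) (hAV : A ⊆ Vs) {c d : V → E} {par : V → V}
    (hc : ∀ v ∈ A, arcs (c v) = {(v₀, v)})
    (hd : ∀ v ∈ Vs, arcs (d v) = {(v, par v)}) (hpar : ∀ v ∈ Vs, par v ∈ Vs ∨ par v = t)
    (honly : OnlyForestCoins arcs v₀ A Vs c d) {rk : V → ℕ}
    (hrk : ∀ v ∈ Vs, par v ∈ Vs → rk (par v) < rk v)
    (ha : a ∉ insert v₀ Vs ∪ {t}) (hb : b ∉ insert v₀ Vs ∪ {t}) (hu : u ∉ insert v₀ Vs ∪ {t})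
    (hP : ∀ Z ∈ (insert v₀ Vs).powerset,
      0 < prob p (avoidEvent (arcsOff arcs (insert v₀ Vs ∪ {t})) s (Z ∪ {t})))
    (hQ : ∀ Z ∈ (insert v₀ Vs).powerset,
      0 < prob p (avoidEvent (arcsOff arcs (insert v₀ Vs ∪ {t})) s (gateTarget u v₀ Z {t}))) :
    DARC p arcs s {t} a b u w := by
  have he' : ∀ xy ∈ arcs e, xy.1 = w := fun xy hxy => by
    rw [he, Finset.mem_singleton] at hxy
    subst hxy
    rfl
  have hwT : w ∉ ({t} : Finset V) := by simpa using hwt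
  refine darc_of_preHead p hp hS s {t} a b u w v₀ e he hin hout hs hwT ?_
  refine darc_of_forestHead_mixed (Function.update p e 1) (isProbVec_update_one hp e) hS s a b u
    v₀ t Vs hv₀V htV hv₀t A hAV hc hd hpar honly hrk ha hb hu ?_ ?_
  · intro Z hZ
    rw [prob_update_one_eq_of_unentered p hin he' hs]
    exact hP Z hZ
  · intro Z hZ
    rw [prob_update_one_eq_of_unentered p hin he' hs]
    exact hQ Z hZ

/-- **Row 2′DARC at the DIAMOND** `w → v₀`, `v₀ → v₁`, `v₀ → v₂`, `v₁ → t`, `v₂ → t` (five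
single-arc coins `e₀, c₁, c₂, d₁, d₂` of arbitrary probabilities; `c₁, c₂, d₁, d₂` the only coins
leaving `{v₀, v₁, v₂}`, `e₀` the only coin leaving `w`, nothing entering `w`; entries from the
core into `v₀, v₁, v₂, t` and the core itself arbitrary mixed; `a, b, u` in the core). -/
theorem darc_of_diamond (p : E → R) (hp : IsProbVec p) {arcs : E → Finset (V × V)}
    (hS : SameEnds arcs) (s a b u w v₀ v₁ v₂ t : V) (e₀ c₁ c₂ d₁ d₂ : E)
    (he₀ : arcs e₀ = {(w, v₀)}) (hc₁ : arcs c₁ = {(v₀, v₁)}) (hc₂ : arcs c₂ = {(v₀, v₂)})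
    (hd₁ : arcs d₁ = {(v₁, t)}) (hd₂ : arcs d₂ = {(v₂, t)})
    (hin : ∀ e', ∀ xy ∈ arcs e', xy.2 ≠ w) (hout : ∀ e', (∃ xy ∈ arcs e', xy.1 = w) → e' = e₀)
    (honly : ∀ e', (∃ xy ∈ arcs e', xy.1 = v₀ ∨ xy.1 = v₁ ∨ xy.1 = v₂) →
      e' = c₁ ∨ e' = c₂ ∨ e' = d₁ ∨ e' = d₂)
    (hs : s ≠ w) (hwt : w ≠ t) (h01 : v₀ ≠ v₁) (h02 : v₀ ≠ v₂) (h12 : v₁ ≠ v₂) (h0t : v₀ ≠ t)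
    (h1t : v₁ ≠ t) (h2t : v₂ ≠ t)
    (ha : a ∉ ({v₀, v₁, v₂, t} : Finset V)) (hb : b ∉ ({v₀, v₁, v₂, t} : Finset V))
    (hu : u ∉ ({v₀, v₁, v₂, t} : Finset V))
    (hP : ∀ Z ∈ ({v₀, v₁, v₂} : Finset V).powerset,
      0 < prob p (avoidEvent (arcsOff arcs ({v₀, v₁, v₂, t} : Finset V)) s (Z ∪ {t})))
    (hQ : ∀ Z ∈ ({v₀, v₁, v₂} : Finset V).powerset,
      0 < prob p (avoidEvent (arcsOff arcs ({v₀, v₁, v₂, t} : Finset V)) s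
        (gateTarget u v₀ Z {t}))) :
    DARC p arcs s {t} a b u w := by
  -- the forest `{v₁, v₂}` with `par ≡ t`, arms `c v` and forest coins `d v` of `v₀`
  let c : V → E := fun v => if v = v₁ then c₁ else c₂
  let d : V → E := fun v => if v = v₁ then d₁ else d₂
  have hVs : ({v₀, v₁, v₂} : Finset V) = insert v₀ {v₁, v₂} := rfl
  have hP' : ({v₀, v₁, v₂, t} : Finset V) = insert v₀ {v₁, v₂} ∪ {t} := by
    ext x; simp
  refine darc_of_preHead_forest p hp hS s a b u w v₀ t e₀ he₀ hin hout hs hwt {v₁, v₂}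
    (by simp [h01, h02]) (by simp [h1t.symm, h2t.symm]) h0t {v₁, v₂} le_rfl
    (c := c) (d := d) (par := fun _ => t) ?_ ?_ (fun v _ => Or.inr rfl) ?_ (rk := fun _ => 0)
    (fun v _ hv => absurd hv (by simp [h1t.symm, h2t.symm])) ?_ ?_ ?_ ?_ ?_
  · -- arms
    intro v hv
    rcases Finset.mem_insert.mp hv with rfl | hv
    · simp [c, hc₁]
    · rw [Finset.mem_singleton] at hv
      subst hv
      simp [c, h12.symm, hc₂]
  · -- forest coins
    intro v hv
    rcases Finset.mem_insert.mp hv with rfl | hv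
    · simp [d, hd₁]
    · rw [Finset.mem_singleton] at hv
      subst hv
      simp [d, h12.symm, hd₂]
  · -- only the five coins leave the head
    intro e' hxy
    obtain ⟨xy, hxy, h⟩ := hxy
    have h' : xy.1 = v₀ ∨ xy.1 = v₁ ∨ xy.1 = v₂ := by
      rcases h with h | h
      · exact Or.inl h
      · rcases Finset.mem_insert.mp h with h | h
        · exact Or.inr (Or.inl h)
        · exact Or.inr (Or.inr (Finset.mem_singleton.mp h))
    rcases honly e' ⟨xy, hxy, h'⟩ with rfl | rfl | rfl | rfl
    · exact Or.inl ⟨v₁, by simp, by simp [c]⟩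
    · exact Or.inl ⟨v₂, by simp, by simp [c, h12.symm]⟩
    · exact Or.inr ⟨v₁, by simp, by simp [d]⟩
    · exact Or.inr ⟨v₂, by simp, by simp [d, h12.symm]⟩
  · rw [← hVs, ← hP']; exact ha
  · rw [← hVs, ← hP']; exact hb
  · rw [← hVs, ← hP']; exact hu
  · rw [← hVs, ← hP']; exact hP
  · rw [← hVs, ← hP']; exact hQ

end PreHeadForest

end Summit.Ventures.PercRepro2.Coin
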